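import Summits.QuantumFields.YangMills.Theses.HistoryWedge
import Summits.QuantumFields.YangMills.Theorems.EntropyFloorGeometricTailOfOrlicz

/-!
# Route `HistoryWedge`, crux `WedgeTailL` (stmt-QuantumFields-27959) is the BOTTOM of the averaged-tail organ: every filed per-plaquette
# currency of crux `HistoryTailL` (stmt-QuantumFields-19936) implies it — floor ⇒ wedge-floor (restriction), hence Orlicz ⇒ wedge and
# window-MGF ⇒ wedge, by kernel theorems

Seat `ym-line-sfw-p2-w2` g20 (width seat of cell `ym-idea-1`, free hands), `--supports stmt-QuantumFields-27959`.  Organ bookkeeping asked by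
critic idea-crit-5 (verdict #105, price (3): «chain for the board: Wedge-floor ⇐ floor ⇐ Orlicz(α) ⇐ window-MGF»).  The two upper edges are
the tree's `EntropyFloorGeometricTailOfOrlicz.geometricTail_of_orliczTailL` (seat ym-ust-19936-w6) and
`ModerateWindowNesting.orliczTailL_of_windowMGFL` (p634346); this file types the bottom edge and the composites:

* `wedgeTailL_of_geometricTail` — the FLOOR currency (the registered text of `stub_geometricTail` of LINE «entropy-floor» on 19936: geometric
  rate `D·ρ^(K−j)`, `ρ·L³ < 1`, for ALL heights `1 ≤ j ≤ K`, with `γ₁` chosen before `m`) implies `WedgeTailL` (the same rate asked only ON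
  THE WEDGE `K ≤ m·(K − j + 1)`, with `γ₁` allowed to depend on `m`): drop the guard, ignore `m`.
* `wedgeTailL_of_orliczTailL : StretchedTail.OrliczTailL → WedgeTailL`, `wedgeTailL_of_windowMGFL : ModerateWindow.WindowMGFL → WedgeTailL`.

So a refutation of `WedgeTailL` would refute the floor, `OrliczTailL` (stmt-QuantumFields-27836) and `WindowMGFL` (stmt-QuantumFields-27839) at
once, and `WedgeTailL` is formally the weakest sufficient per-plaquette statement on the organ's board
(`HistoryWedgeGlue.historyTailL_of_wedgeTailL`: it still gives `HistoryTailL`).  HONEST FRAMING: nothing here proves `WedgeTailL`, the floor,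
`OrliczTailL`, `WindowMGFL`, `HistoryTailL`, the rung `YM3TorusSU2` (a RECORD rung) or any mass gap.  No `def`, no `sorry`.

References: T. Bałaban, CMP **102** (1985) 255–275 [Balaban1985UV3] ((71) p.273: per-plaquette large-field factors); C. King, CMP **102** (1986)
649–677 [King1986] ((3.12) p.657).
-/

set_option autoImplicit false

noncomputable section

namespace Summit.QuantumFields.YangMills.Theorems.HistoryWedgeGlue

open Literature.MathematicalPhysics.QuantumFieldTheory
open Literature.MathematicalPhysics.QuantumFieldTheory.Balaban1983to89
open Literature.MathematicalPhysics.QuantumFieldTheory.Balaban1983to89.T3ContinuumYM3Torus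
open Literature.MathematicalPhysics.QuantumFieldTheory.Balaban1983to89.T3UnitScaleTilt
open Literature.MathematicalPhysics.QuantumFieldTheory.Balaban1983to89.T3UnitLawDensityEML
open Summit.QuantumFields.YangMills.Theses.HistoryWedge (WedgeTailL)
open Summit.QuantumFields.YangMills.Theorems.EntropyFloorGeometricTailOfOrlicz (geometricTail_of_orliczTailL geometricTail_of_windowMGFL)

/-- ★ **FLOOR ⇒ WEDGE-FLOOR**: the floor currency of the per-plaquette family (geometric rate `D·ρ^(K−j)`, `ρ·L³ < 1`, at EVERY height
`1 ≤ j ≤ K`, `γ₁` before `m` — verbatim the registered text of `stub_geometricTail` of LINE «entropy-floor» on crux `HistoryTailL`) implies the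
route crux `WedgeTailL` (the same rate only on the wedge `K ≤ m·(K − j + 1)`, `γ₁` after `m`): the wedge guard is dropped and `m` ignored.
[cite: Balaban1985UV3, (71) p.273] -/
theorem wedgeTailL_of_geometricTail
    (hG : ∀ (L : ℕ) (b₁ p₁ : ℝ), ∃ (b₀ p₀ : ℝ), b₁ ≤ b₀ ∧ p₁ ≤ p₀ ∧ 0 < b₀ ∧ 2 < p₀ ∧ ∃ γ₁ : ℝ, 0 < γ₁ ∧ γ₁ ≤ 1 ∧
      ∀ (F : T3Family) (γ : ℝ), F.L = L → 0 < γ → γ ≤ γ₁ → ∃ (D ρ : ℝ), 0 ≤ D ∧ 0 ≤ ρ ∧ ρ * (L : ℝ) ^ 3 < 1 ∧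
        ∀ (K j : ℕ), 1 ≤ j → j ≤ K → ∀ (p : Plaq (F.P K) j),
          (gibbsK F ℰp γ K).real {U | θBal F.L γ b₀ p₀ (K - j) ≤
              GaugeGroup.dist1 (GaugeField.plaqHol (Averaging.iter (fun i => BlockAveraging.blockAvg (P := F.P K) (j := i) ℰp) j U) p)}
            ≤ D * ρ ^ (K - j)) :
    WedgeTailL := by
  intro L b₁ p₁
  obtain ⟨b₀, p₀, hb₁, hp₁, hb₀, hp₀, γ₁, hγ₁, hγ₁1, hF⟩ := hG L b₁ p₁
  refine ⟨b₀, p₀, hb₁, hp₁, hb₀, hp₀, fun m _ => ⟨γ₁, hγ₁, hγ₁1, fun F γ hFL hγ hγle => ?_⟩⟩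
  obtain ⟨D, ρ, hD, hρ, hρL, hB⟩ := hF F γ hFL hγ hγle
  exact ⟨D, ρ, hD, hρ, hρL, fun K j hj hjK _ p => hB K j hj hjK p⟩

/-- ★ **ORLICZ ⇒ WEDGE-FLOOR**: the crux `OrliczTailL` of route `StretchedTail` (stmt-QuantumFields-27836) implies `WedgeTailL` — through the
floor (`EntropyFloorGeometricTailOfOrlicz.geometricTail_of_orliczTailL`: ψ_α-Chebyshev, `αp₀ ≥ 2`, log-square beats `L^{(3+A)i}`) and
`wedgeTailL_of_geometricTail`. [cite: Balaban1985UV3, (71) p.273] -/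
theorem wedgeTailL_of_orliczTailL (hO : Summit.QuantumFields.YangMills.Theses.StretchedTail.OrliczTailL) : WedgeTailL :=
  wedgeTailL_of_geometricTail (geometricTail_of_orliczTailL hO)

/-- ★ **WINDOW-MGF ⇒ WEDGE-FLOOR**: the crux `WindowMGFL` of route `ModerateWindow` (stmt-QuantumFields-27839) implies `WedgeTailL` — through
`OrliczTailL` (`ModerateWindowNesting.orliczTailL_of_windowMGFL`) and the floor. [cite: Balaban1985UV3, (71) p.273] -/
theorem wedgeTailL_of_windowMGFL (hW : Summit.QuantumFields.YangMills.Theses.ModerateWindow.WindowMGFL) : WedgeTailL :=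
  wedgeTailL_of_geometricTail (geometricTail_of_windowMGFL hW)

end Summit.QuantumFields.YangMills.Theorems.HistoryWedgeGlue

end
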